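import Literature.AnabelianGeometry.SemiGraphs.UniversalCoveringOver

/-!
# Deck transformations of `𝒢_{∞,S} → 𝒢_S` ([SemiAnbd] §3 p. 38)

Sequel to `UniversalCoveringOver.lean`: the topological fundamental group `π₁(𝔾_S, c)` of the
underlying semi-graph of the covering `S` acts on `𝒢_{∞,S} = univCoverOver S c` by automorphisms
over `S` (precomposition of the path component with `γ⁻¹`) — [SemiAnbd] p. 38:
"`Gal(𝒢_{∞,i}/𝒢_i) ≅ π₁(𝔾_i)`" (here: the inclusion `π₁(𝔾_S) → Aut_S(𝒢_{∞,S})`, with the action free,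
and transitive on the fibres of `𝒢_{∞,S} → 𝒢_S`).
-/

namespace Literature.AnabelianGeometry.SemiGraphs

namespace ProfiniteSemiGraph

open CategoryTheory

universe u

variable {𝒢 : ProfiniteSemiGraph.{u}} (S : CovObj 𝒢) (c : S.orbitGraph.CatCarrier)
  (h𝒢 : 𝒢.IsCountable)

/-- The deck transformation of `γ ∈ π₁(𝔾_S, c)` on `𝒢_{∞,S}`: `(V, x, p) ↦ (V, x, γ⁻¹ ≫ p)`.
[cite: MochizukiSemiAnbd2006, Prop 3.6 p.38] -/
noncomputable def CovObj.deckOver (γ : S.orbitGraph.FundamentalGroup c) :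
    S.univCoverOver c h𝒢 ⟶ S.univCoverOver c h𝒢 where
  fV v := ObjectProperty.homMk
    { hom := TypeCat.ofHom fun t : S.FibV c v => ⟨t.1, ⟨t.2.1, inv γ ≫ t.2.2⟩⟩
      comm := fun _ => rfl }
  fE e := ObjectProperty.homMk
    { hom := TypeCat.ofHom fun t : S.FibE c e => ⟨t.1, ⟨t.2.1, inv γ ≫ t.2.2⟩⟩
      comm := fun _ => rfl }
  comm b v h := by
    apply ObjectProperty.hom_ext
    apply Action.Hom.ext
    apply ConcreteCategory.hom_ext
    intro t
    exact CovObj.FibV.ext S c rfl rfl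
      (heq_of_eq (Category.assoc (inv γ) t.2.2 (S.brArrowOver b v h t.1 t.2.1.1 t.2.1.2)))

/-- Deck transformations lie over `S`. [cite: MochizukiSemiAnbd2006, Prop 3.6 p.38] -/
theorem CovObj.deckOver_comp_proj (γ : S.orbitGraph.FundamentalGroup c) :
    S.deckOver c h𝒢 γ ≫ S.univCoverOverProj c h𝒢 = S.univCoverOverProj c h𝒢 := by
  refine CovHom.ext (funext fun v => ?_) (funext fun e => ?_) <;> rfl

/-- `deckOver 1 = 𝟙`. [cite: MochizukiSemiAnbd2006, Prop 3.6 p.38] -/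
theorem CovObj.deckOver_one : S.deckOver c h𝒢 1 = 𝟙 _ := by
  have h1 : inv (𝟙 (S.orbitGraph.basept c)) = 𝟙 _ := IsIso.inv_id
  refine CovHom.ext (funext fun v => ?_) (funext fun e => ?_)
  · apply ObjectProperty.hom_ext
    apply Action.Hom.ext
    apply ConcreteCategory.hom_ext
    intro t
    refine CovObj.FibV.ext S c rfl rfl (heq_of_eq ?_)
    change inv (𝟙 _) ≫ t.2.2 = t.2.2
    rw [h1, Category.id_comp]
  · apply ObjectProperty.hom_ext
    apply Action.Hom.ext
    apply ConcreteCategory.hom_ext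
    intro t
    refine CovObj.FibE.ext S c rfl rfl (heq_of_eq ?_)
    change inv (𝟙 _) ≫ t.2.2 = t.2.2
    rw [h1, Category.id_comp]

/-- `deckOver (γ * δ) = deckOver γ ≫ deckOver δ`. [cite: MochizukiSemiAnbd2006, Prop 3.6 p.38] -/
theorem CovObj.deckOver_mul (γ δ : S.orbitGraph.FundamentalGroup c) :
    S.deckOver c h𝒢 (γ * δ) = S.deckOver c h𝒢 γ ≫ S.deckOver c h𝒢 δ := by
  have hinv : inv (γ ≫ δ) = inv δ ≫ inv γ := IsIso.inv_comp
  refine CovHom.ext (funext fun v => ?_) (funext fun e => ?_)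
  · apply ObjectProperty.hom_ext
    apply Action.Hom.ext
    apply ConcreteCategory.hom_ext
    intro t
    refine CovObj.FibV.ext S c rfl rfl (heq_of_eq ?_)
    change inv (γ ≫ δ) ≫ t.2.2 = inv δ ≫ (inv γ ≫ t.2.2)
    rw [hinv, Category.assoc]
  · apply ObjectProperty.hom_ext
    apply Action.Hom.ext
    apply ConcreteCategory.hom_ext
    intro t
    refine CovObj.FibE.ext S c rfl rfl (heq_of_eq ?_)
    change inv (γ ≫ δ) ≫ t.2.2 = inv δ ≫ (inv γ ≫ t.2.2)
    rw [hinv, Category.assoc]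

/-- **The deck automorphism of `𝒢_{∞,S}` over `S` attached to `γ ∈ π₁(𝔾_S, c)`.**
[cite: MochizukiSemiAnbd2006, Prop 3.6 p.38] -/
noncomputable def CovObj.deckOverAut (γ : S.orbitGraph.FundamentalGroup c) :
    S.univCoverOver c h𝒢 ≅ S.univCoverOver c h𝒢 where
  hom := S.deckOver c h𝒢 γ
  inv := S.deckOver c h𝒢 γ⁻¹
  hom_inv_id := by rw [← CovObj.deckOver_mul, mul_inv_cancel, CovObj.deckOver_one]
  inv_hom_id := by rw [← CovObj.deckOver_mul, inv_mul_cancel, CovObj.deckOver_one]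

/-- The deck action is free (on the fibre over every vertex): `γ · t = t ↔ γ = 1`.
[cite: MochizukiSemiAnbd2006, Prop 3.6 p.38] -/
theorem CovObj.deckOver_apply_eq_self_iff (γ : S.orbitGraph.FundamentalGroup c)
    (v : 𝒢.graph.Vertex) (t : S.FibV c v) :
    ((S.deckOver c h𝒢 γ).fV v).hom.hom t = t ↔ γ = 1 := by
  constructor
  · intro ht
    obtain ⟨V, xx, p⟩ := t
    have ht' : (⟨V, ⟨xx, inv γ ≫ p⟩⟩ : S.FibV c v) = ⟨V, ⟨xx, p⟩⟩ := ht
    have hp : inv γ ≫ p = p := by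
      have := (Sigma.mk.inj_iff.mp ht').2
      exact (Prod.mk.inj (eq_of_heq this)).2
    have : inv γ = 𝟙 _ := by
      rw [← cancel_mono p, Category.id_comp]
      exact hp
    exact IsIso.inv_eq_inv.mp (this.trans IsIso.inv_id.symm)
  · rintro rfl
    refine CovObj.FibV.ext S c rfl rfl (heq_of_eq ?_)
    change inv (𝟙 (S.orbitGraph.basept c)) ≫ t.2.2 = t.2.2
    rw [show inv (𝟙 (S.orbitGraph.basept c)) = 𝟙 _ from IsIso.inv_id, Category.id_comp]

end ProfiniteSemiGraph

end Literature.AnabelianGeometry.SemiGraphs
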